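import Summits.ResolutionOfSingularities.ResolutionOfSingularities.Theorems.DeltaCutStellar
import Literature.AlgebraicGeometry.Resolution.SncStrata
import Literature.AlgebraicGeometry.Resolution.DivisorialPartLemmas

/-!
# DeltaCutStellarSupport — ADDENDUM tree file 3 (after 1/2, 2/2) of the decomp-res lens-6 g32 node «StellarCut»: §NCSupport — the FIRST SCHEME-LEVEL
# FACTS about the ideal-shape letter `IsNCStage` (g33 window, transfer step (a) `label_rule`, first rungs; tool, 0-currency)

For an n.c. frame `F` on a stage `N = (Y, 𝓘)` in the IDEAL SHAPE `𝓘 = 𝓘(H)ⁿ + Π 𝓘(Dᵢ)^{aᵢ}` (`NCFrame.IdealShape`), by pure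
support calculus of Mathlib's ideal sheaves (`support_sup`, `support_mul`, `support_pow`, `coe_support_vanishingIdeal`) and the
Literature order API (`one_le_idealOrder_iff`):

* `NCFrame.mem_support_boundary_iff` — `Supp(𝒪/𝓜) = ⋃_{aᵢ ≠ 0} Dᵢ` for the monomial part `𝓜 = Π 𝓘(Dᵢ)^{aᵢ}`;
* `NCFrame.mem_support_ideal_iff_of_idealShape` — `Supp(𝒪/𝓘) = H ∩ ⋃_{aᵢ ≠ 0} Dᵢ` (`n ≠ 0`);
* `NCFrame.top_subset_of_idealShape` — THE COARSE LABEL RULE: `Supp(𝓘, n) ⊆ H ∩ ⋃_{aᵢ ≠ 0} Dᵢ` (`1 ≤ n`);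
* `NCFrame.labelRule_one` — THE LABEL RULE AT MARKING ONE, exactly: `Supp(𝓘, 1) = H ∩ {y | Σ_{Dᵢ ∋ y} aᵢ ≥ 1}`;
* `NCFrame.le_idealOrder_of_labels` — THE LABEL RULE, LOWER HALF, exactly and without s.n.c.: `H ∩ {y | Σ_{Dᵢ ∋ y} aᵢ ≥ n} ⊆
  Supp(𝓘, n)` (stalk calculus `stalkIdeal_mul/pow/add/finset_prod`, `prod_pow_le_pow_sum`);
* `NCFrame.top_iff_of_labels_ge` — THE LABEL RULE EXACTLY whenever every positive label is `≥ n`: `Supp(𝓘, n) = H ∩ ⋃_{aᵢ≠0} Dᵢ`;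
* `NCFrame.suppLE_of_idealShape` — in the ideal shape the non-degeneracy clause `SuppLE` is AUTOMATIC (`1 ≤ n`), whence
  `isNCStage_of_idealShape : F.IsSNC → F.IdealShape n → 1 ≤ n → IsNCStage n N` (the letter needs only the frame and the shape);
* `MarkedIdeal`-level readings for data: `support_subset_of_idealShape`, `mem_support_of_labels` (`IsDatum n M`).

* THE SHARP UPPER HALF and THE LABEL RULE (s.n.c. frame, `1 ≤ n`): `NCFrame.IsSNC.exists_isRsopPart_generators` (at a point of
  the divisor the boundary components through it are cut out by members of ONE part of a regular system of parameters — generic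
  points are maximal points of the s.n.c. divisor, Literature `SncStrata`), `isRsopPart_finsetProd_pow_not_mem_pow` (a monomial in
  an r.s.p. part has order exactly its degree, Literature `RegularLocalOrder`), `NCFrame.labels_ge_of_le_idealOrder`
  (`Supp(𝓘, n) ⊆ {y | Σ_{Dᵢ ∋ y} aᵢ ≥ n}`) and `NCFrame.labelRule : ord_y 𝓘 ≥ n ↔ y ∈ H ∧ Σ_{Dᵢ ∋ y} aᵢ ≥ n` (g33 window (1)(a)).

The transform rule (window (1)(b)) is NOT claimed here (list-level version: the sequel `DeltaCutStellarTransform`). 0 sorry.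
[new] [folklore]
-/

noncomputable section

open CategoryTheory CategoryTheory.Limits AlgebraicGeometry TopologicalSpace IsLocalRing
open Literature.AlgebraicGeometry.Resolution

namespace Summit.ResolutionOfSingularities.ResolutionOfSingularities.Theorems.DeltaCutClasses

open Summit.ResolutionOfSingularities.ResolutionOfSingularities.Theorems.TwistCutClasses
open Summit.ResolutionOfSingularities.ResolutionOfSingularities.Theorems.LightCutClasses

section NCSupport

open Summit.ResolutionOfSingularities.ResolutionOfSingularities.Theorems
open WeakOrderReduction ForcedTowerClasses SubfieldContactClasses AbsoluteContactClasses PurityValveClasses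
open Scheme.IdealSheafData (vanishingIdeal)

/-! ### §NCSupport — support calculus of the ideal shape (first scheme-level facts about `IsNCStage`) -/

/-- support of a finite product of ideal sheaves: a point lies in `Supp(𝒪/Π_{i∈s} Iᵢ)` iff it lies in some `Supp(𝒪/Iᵢ)`.
[folklore] -/
theorem mem_support_finset_prod_iff {X : Scheme} {ι : Type*} (s : Finset ι) (I : ι → X.IdealSheafData) (y : X) :
    y ∈ (∏ i ∈ s, I i).support ↔ ∃ i ∈ s, y ∈ (I i).support := by
  classical
  refine Finset.induction_on s ?_ ?_
  · simp only [Finset.prod_empty, Scheme.IdealSheafData.one_eq_top, Scheme.IdealSheafData.support_top,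
      Finset.notMem_empty, false_and, exists_false, iff_false]
    exact id
  · intro a s ha ih
    rw [Finset.prod_insert ha, Scheme.IdealSheafData.support_mul, ← SetLike.mem_coe, Closeds.coe_sup, Set.mem_union,
      SetLike.mem_coe, SetLike.mem_coe, ih]
    simp only [Finset.mem_insert, exists_eq_or_imp]

/-! #### stalk calculus (general ideal sheaves) -/

section StalkCalculus

variable {X : Scheme}

/-- the stalk of a power of an ideal sheaf is the power of the stalk. [folklore] -/
-- writer g14: `stalkIdeal_mul` and `stalkIdeal_finset_prod` deleted here — dedup.landed twins of
-- `Literature.AlgebraicGeometry.Resolution.stalkIdeal_mul` [MarkedIdealsLemmas] and `…stalkIdeal_finset_prod` [DivisorialPartLemmas]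
-- (imported above, namespace already open); use sites below resolve to the Literature declarations unchanged.
theorem stalkIdeal_pow (I : X.IdealSheafData) (x : X) (n : ℕ) : stalkIdeal (I ^ n) x = stalkIdeal I x ^ n := by
  induction n with
  | zero => rw [pow_zero, pow_zero, Scheme.IdealSheafData.one_eq_top, stalkIdeal_top, Ideal.one_eq_top]
  | succ k ih => rw [pow_succ, pow_succ, stalkIdeal_mul, ih]

/-- the stalk of a sum of ideal sheaves is the sum of the stalks. [folklore] -/
theorem stalkIdeal_add (I J : X.IdealSheafData) (x : X) : stalkIdeal (I + J) x = stalkIdeal I x ⊔ stalkIdeal J x := by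
  obtain ⟨U, hU, hxU, -⟩ := exists_isAffineOpen_mem_and_subset (X := X) (x := x) (U := ⊤) (Opens.mem_top x)
  rw [add_eq_sup, stalkIdeal_eq_map_germ _ ⟨U, hU⟩ hxU, stalkIdeal_eq_map_germ _ ⟨U, hU⟩ hxU,
    stalkIdeal_eq_map_germ _ ⟨U, hU⟩ hxU, Scheme.IdealSheafData.ideal_sup, Pi.sup_apply, Ideal.map_sup]

/-- at a point of a closed subset, the stalk of its vanishing ideal sheaf lies in the maximal ideal. [folklore] -/
theorem stalkIdeal_vanishingIdeal_le_maximalIdeal {Z : Closeds X} {x : X} (hx : x ∈ (Z : Set X)) :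
    stalkIdeal (vanishingIdeal Z) x ≤ maximalIdeal (X.presheaf.stalk x) :=
  (mem_support_iff_stalkIdeal_le _ x).1
    (by rw [← SetLike.mem_coe, Scheme.IdealSheafData.coe_support_vanishingIdeal]; exact hx)

/-- a product of powers of ideals, those indexed by `S` lying in `m`, lies in `m ^ (Σ_S aᵢ)`. [folklore] -/
theorem prod_pow_le_pow_sum {R : Type*} [CommSemiring R] {ι : Type*} (s S : Finset ι) (hS : S ⊆ s) (J : ι → Ideal R)
    (m : Ideal R) (a : ι → ℕ) (h : ∀ i ∈ S, J i ≤ m) : ∏ i ∈ s, J i ^ a i ≤ m ^ (∑ i ∈ S, a i) := by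
  classical
  have hS' : ∏ i ∈ S, J i ^ a i ≤ m ^ (∑ i ∈ S, a i) := by
    revert h
    refine Finset.induction_on S ?_ ?_
    · intro _
      rw [Finset.prod_empty, Finset.sum_empty, pow_zero]
    · intro b S hb ih h
      rw [Finset.prod_insert hb, Finset.sum_insert hb, pow_add]
      exact Ideal.mul_mono (Ideal.pow_right_mono (h b (Finset.mem_insert_self b S)) _)
        (ih fun i hi => h i (Finset.mem_insert_of_mem hi))
  rw [← Finset.prod_sdiff hS]
  exact le_trans Ideal.mul_le_left hS'

end StalkCalculus

/-! #### monomial orders in a regular local ring (Literature `RegularLocalOrder`: the order is additive) -/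

/-- **a monomial in members of a part of a regular system of parameters has order exactly its degree**: it does not lie in
`𝔪^{deg+1}` (Zariski–Samuel VIII §1 Thm. 1 via `mul_not_mem_pow_of_not_mem_pow`, `pow_not_mem_pow_of_not_mem_pow`,
`IsRsopPart.not_mem_sq`; repetitions in `k` allowed). [folklore] -/
theorem isRsopPart_finsetProd_pow_not_mem_pow {R : Type*} [CommRing R] [IsLocalRing R] {m : ℕ} {z : Fin m → R}
    (hz : IsRsopPart z) {σ : Type*} (S : Finset σ) (k : σ → Fin m) (a : σ → ℕ) :
    ∏ s ∈ S, z (k s) ^ a s ∉ maximalIdeal R ^ (∑ s ∈ S, a s + 1) := by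
  classical
  haveI := hz.isRegularLocalRing
  refine Finset.induction_on S ?_ ?_
  · rw [Finset.prod_empty, Finset.sum_empty, zero_add, pow_one]
    exact fun h => (maximalIdeal.isMaximal R).ne_top (Ideal.eq_top_of_isUnit_mem _ h isUnit_one)
  · intro s S hs ih
    rw [Finset.prod_insert hs, Finset.sum_insert hs]
    have h0 : z (k s) ∉ maximalIdeal R ^ (1 + 1) := hz.not_mem_sq (k s)
    have h1 : z (k s) ^ a s ∉ maximalIdeal R ^ (a s * 1 + 1) := pow_not_mem_pow_of_not_mem_pow h0 (a s)
    rw [mul_one] at h1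
    exact mul_not_mem_pow_of_not_mem_pow h1 ih

namespace NCFrame

variable {N : Stage}

/-- **support of the monomial part**: `y ∈ Supp(𝒪/𝓜)` iff `y ∈ Dᵢ` for some `i` with `aᵢ ≠ 0`. [new] [folklore] -/
theorem mem_support_boundary_iff (F : NCFrame N) (y : N.Y) :
    y ∈ F.boundary.support ↔ ∃ i, F.a i ≠ 0 ∧ y ∈ (F.D i : Set N.Y) := by
  unfold boundary
  rw [mem_support_finset_prod_iff]
  simp only [Finset.mem_univ, true_and]
  refine exists_congr fun i => ?_
  rcases Nat.eq_zero_or_pos (F.a i) with h | h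
  · simp only [h, pow_zero, Scheme.IdealSheafData.one_eq_top, Scheme.IdealSheafData.support_top, ne_eq,
      not_true_eq_false, false_and, iff_false]
    exact id
  · rw [Scheme.IdealSheafData.support_pow _ _ h.ne', ← SetLike.mem_coe, Scheme.IdealSheafData.coe_support_vanishingIdeal]
    simp only [ne_eq, h.ne', not_false_eq_true, true_and, SetLike.mem_coe]

/-- **support of an ideal-shape ideal**: for `𝓘 = 𝓘(H)ⁿ + 𝓜` with `n ≠ 0`, `Supp(𝒪/𝓘) = H ∩ ⋃_{aᵢ ≠ 0} Dᵢ`. [new] [folklore] -/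
theorem mem_support_ideal_iff_of_idealShape {n : ℕ} (hn : n ≠ 0) {F : NCFrame N} (hF : F.IdealShape n) (y : N.Y) :
    y ∈ N.I.support ↔ y ∈ (F.H : Set N.Y) ∧ ∃ i, F.a i ≠ 0 ∧ y ∈ (F.D i : Set N.Y) := by
  rw [hF, add_eq_sup, Scheme.IdealSheafData.support_sup, ← SetLike.mem_coe, Closeds.coe_inf, Set.mem_inter_iff,
    Scheme.IdealSheafData.support_pow _ _ hn, Scheme.IdealSheafData.coe_support_vanishingIdeal]
  simp only [SetLike.mem_coe, mem_support_boundary_iff]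

/-- **THE COARSE LABEL RULE** (ideal shape, `1 ≤ n`): the top locus `Supp(𝓘, n)` lies in `H ∩ ⋃_{aᵢ ≠ 0} Dᵢ`. [new] [folklore] -/
theorem top_subset_of_idealShape {n : ℕ} (hn : 1 ≤ n) {F : NCFrame N} (hF : F.IdealShape n) {y : N.Y}
    (hy : (n : ℕ∞) ≤ idealOrder N.I y) : y ∈ (F.H : Set N.Y) ∧ ∃ i, F.a i ≠ 0 ∧ y ∈ (F.D i : Set N.Y) := by
  have h1 : (1 : ℕ∞) ≤ idealOrder N.I y := le_trans (by exact_mod_cast hn) hy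
  exact (mem_support_ideal_iff_of_idealShape (by omega) hF y).1 ((one_le_idealOrder_iff N.I y).1 h1)

/-- **THE LABEL RULE AT MARKING ONE, exactly**: for `𝓘 = 𝓘(H) + 𝓜`, `Supp(𝓘, 1) = H ∩ {y | Σ_{Dᵢ ∋ y} aᵢ ≥ 1}`.
[new] [folklore] -/
theorem labelRule_one {F : NCFrame N} (hF : F.IdealShape 1) (y : N.Y) :
    ((1 : ℕ) : ℕ∞) ≤ idealOrder N.I y ↔ y ∈ (F.H : Set N.Y) ∧ ∃ i, F.a i ≠ 0 ∧ y ∈ (F.D i : Set N.Y) := by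
  rw [Nat.cast_one, one_le_idealOrder_iff]
  exact mem_support_ideal_iff_of_idealShape one_ne_zero hF y

/-- **IN THE IDEAL SHAPE THE NON-DEGENERACY CLAUSE IS AUTOMATIC** (`1 ≤ n`): `F.IdealShape n → F.SuppLE n`. [new] [folklore] -/
theorem suppLE_of_idealShape {n : ℕ} (hn : 1 ≤ n) {F : NCFrame N} (hF : F.IdealShape n) : F.SuppLE n :=
  fun _ hy => (top_subset_of_idealShape hn hF hy).1

/-- **THE LABEL RULE, lower half (ideal shape, exactly; no s.n.c. needed)**: at a point `y ∈ H` lying on boundary components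
`Dᵢ, i ∈ S` with `Σ_{i∈S} aᵢ ≥ n`, the order of `𝓘 = 𝓘(H)ⁿ + 𝓜` is `≥ n`, i.e. `H ∩ {y | Σ_{Dᵢ ∋ y} aᵢ ≥ n} ⊆ Supp(𝓘, n)`
(stalk calculus: `𝓘(H)_yⁿ ⊆ 𝔪_yⁿ` and `𝓜_y ⊆ 𝔪_y^{Σ_S aᵢ} ⊆ 𝔪_yⁿ`). [new] [folklore] -/
theorem le_idealOrder_of_labels {n : ℕ} {F : NCFrame N} (hF : F.IdealShape n) {y : N.Y} (hyH : y ∈ (F.H : Set N.Y))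
    {S : Finset (Fin F.r)} (hS : ∀ i ∈ S, y ∈ (F.D i : Set N.Y)) (hn : n ≤ ∑ i ∈ S, F.a i) :
    (n : ℕ∞) ≤ idealOrder N.I y := by
  rw [le_idealOrder_iff, hF, stalkIdeal_add, stalkIdeal_pow]
  refine sup_le (Ideal.pow_right_mono (stalkIdeal_vanishingIdeal_le_maximalIdeal hyH) n) ?_
  unfold boundary
  rw [stalkIdeal_finset_prod]
  simp_rw [stalkIdeal_pow]
  exact le_trans (prod_pow_le_pow_sum _ _ (Finset.subset_univ S) _ _ _
    (fun i hi => stalkIdeal_vanishingIdeal_le_maximalIdeal (hS i hi))) (Ideal.pow_le_pow_right hn)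

/-- **THE LABEL RULE, exactly, when every positive label is `≥ n`** (e.g. right after the first face blow-ups, or for
`D₀`-type stages `(x², z⁴w⁴)`): `Supp(𝓘, n) = H ∩ ⋃_{aᵢ ≠ 0} Dᵢ` — the coarse upper half meets the lower half with `S = {i}`.
[new] [folklore] -/
theorem top_iff_of_labels_ge {n : ℕ} (hn : 1 ≤ n) {F : NCFrame N} (hF : F.IdealShape n)
    (ha : ∀ i, F.a i ≠ 0 → n ≤ F.a i) (y : N.Y) :
    (n : ℕ∞) ≤ idealOrder N.I y ↔ y ∈ (F.H : Set N.Y) ∧ ∃ i, F.a i ≠ 0 ∧ y ∈ (F.D i : Set N.Y) := by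
  refine ⟨fun hy => top_subset_of_idealShape hn hF hy, fun ⟨hH, i, hi, hD⟩ => ?_⟩
  refine le_idealOrder_of_labels hF hH (S := {i}) (fun j hj => ?_) (by rw [Finset.sum_singleton]; exact ha i hi)
  rw [Finset.mem_singleton] at hj
  subst hj
  exact hD

/-- **boundary components are cut out by members of ONE regular system of parameters** (s.n.c. frame): at a point `y` of the
divisor `H ∪ ⋃ Dᵢ` there is a part `z` of a regular system of parameters of `𝒪_{Y,y}` such that every `Dᵢ ∋ y` has
`𝓘(Dᵢ)_y = (z_j)` for some `j` — the generic point of `Dᵢ` is a maximal point of the divisor (irreducibility + mutual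
non-containment), so its prime is a minimal prime of `𝓘(H ∪ ⋃ Dᵢ)_y = (∏ z_j)` (`SncStrata`), i.e. some `(z_j)`, and
`𝓘(cl{η})_y = 𝔭_η` (`stalkIdeal_vanishingIdeal_closure`). [new] [folklore] -/
theorem IsSNC.exists_isRsopPart_generators {F : NCFrame N} (hS : F.IsSNC) {y : N.Y}
    (hy : y ∈ (F.H : Set N.Y) ∪ ⋃ i, (F.D i : Set N.Y)) :
    ∃ (m : ℕ) (z : Fin m → N.Y.presheaf.stalk y), IsRsopPart z ∧
      ∀ i, y ∈ (F.D i : Set N.Y) → ∃ j, stalkIdeal (vanishingIdeal (F.D i)) y = Ideal.span {z j} := by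
  obtain ⟨hsnc, -, hDirr, -, hDH, hDD⟩ := hS
  have hZc : IsClosed ((F.H : Set N.Y) ∪ ⋃ i, (F.D i : Set N.Y)) := hsnc.isClosed
  have hAt := hsnc.isStrictNormalCrossingsAt hy
  obtain ⟨m, z, -, hz, hIZ⟩ := (isSNCIdeal_iff_exists_isRsopPart _).1 hAt
  have hcl : (⟨closure ((F.H : Set N.Y) ∪ ⋃ i, (F.D i : Set N.Y)), isClosed_closure⟩ : Closeds N.Y) =
      ⟨(F.H : Set N.Y) ∪ ⋃ i, (F.D i : Set N.Y), hZc⟩ := Closeds.ext hZc.closure_eq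
  rw [hcl] at hIZ
  refine ⟨m, z, hz, fun i hyi => ?_⟩
  obtain ⟨η, hη⟩ := QuasiSober.sober (hDirr i) (F.D i).isClosed
  have h : η ⤳ y := hη.specializes hyi
  have hηmax : η ∈ maxPoints (((⟨(F.H : Set N.Y) ∪ ⋃ i, (F.D i : Set N.Y), hZc⟩ : Closeds N.Y)) : Set N.Y) := by
    rw [mem_maxPoints_iff]
    refine ⟨Set.mem_union_right _ (Set.mem_iUnion.2 ⟨i, hη.mem⟩), fun η' hη' hs => ?_⟩
    have hsub : (F.D i : Set N.Y) ⊆ closure {η'} :=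
      (hη.mem_closed_set_iff isClosed_closure).1 (specializes_iff_mem_closure.1 hs)
    rcases hη' with hH | hD
    · exact absurd (hsub.trans (closure_minimal (Set.singleton_subset_iff.2 hH) F.H.isClosed)) (hDH i)
    · obtain ⟨j, hj⟩ := Set.mem_iUnion.1 hD
      have hsub' : closure {η'} ⊆ (F.D j : Set N.Y) :=
        closure_minimal (Set.singleton_subset_iff.2 hj) (F.D j).isClosed
      by_cases hji : j = i
      · subst hji
        exact IsGenericPoint.eq (show IsGenericPoint η' (F.D j : Set N.Y) from Set.Subset.antisymm hsub' hsub) hη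
      · exact absurd (hsub.trans hsub') (hDD i j (Ne.symm hji))
  have hmin := primeOfSpecializes_mem_minimalPrimes_of_mem_maxPoints hηmax h
  rw [hIZ, hz.mem_minimalPrimes_span_prod_iff] at hmin
  obtain ⟨j, hj⟩ := hmin
  refine ⟨j, ?_⟩
  have hDi : F.D i = ⟨closure {η}, isClosed_closure⟩ := Closeds.ext hη.def.symm
  rw [hDi, stalkIdeal_vanishingIdeal_closure h, hj]

/-- **THE LABEL RULE, upper half (sharp; uses the s.n.c. frame)**: in the ideal shape, if `ord_y 𝓘 ≥ n` then the labels of the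
boundary components through `y` add up to at least `n` — the stalk of the monomial part is generated by a MONOMIAL in a regular
system of parameters, whose order is its degree. [new] [folklore] -/
theorem labels_ge_of_le_idealOrder {n : ℕ} {F : NCFrame N} (hS : F.IsSNC) (hF : F.IdealShape n) {y : N.Y}
    (hy : (n : ℕ∞) ≤ idealOrder N.I y) :
    ∃ S : Finset (Fin F.r), (∀ i ∈ S, y ∈ (F.D i : Set N.Y)) ∧ n ≤ ∑ i ∈ S, F.a i := by
  classical
  rcases Nat.eq_zero_or_pos n with hn0 | hn
  · exact ⟨∅, by simp, by simp [hn0]⟩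
  have hyH : y ∈ (F.H : Set N.Y) := (top_subset_of_idealShape hn hF hy).1
  obtain ⟨m, z, hz, hgen⟩ := hS.exists_isRsopPart_generators (Set.mem_union_left _ hyH)
  haveI := hz.isRegularLocalRing
  choose k hk using hgen
  let S : Finset (Fin F.r) := Finset.univ.filter fun i => y ∈ (F.D i : Set N.Y)
  have hSmem : ∀ i ∈ S, y ∈ (F.D i : Set N.Y) := fun i hi => (Finset.mem_filter.1 hi).2
  have hSnot : ∀ i, i ∉ S → y ∉ (F.D i : Set N.Y) := fun i hi h => hi (Finset.mem_filter.2 ⟨Finset.mem_univ i, h⟩)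
  refine ⟨S, hSmem, ?_⟩
  by_contra hlt
  -- the monomial `∏_{Dᵢ ∋ y} z_{k i}^{aᵢ}` has order `Σ_S aᵢ < n` …
  have hMnot : ∏ s ∈ S.attach, z (k s.1 (hSmem s.1 s.2)) ^ F.a s.1 ∉
      maximalIdeal _ ^ (∑ s ∈ S.attach, F.a s.1 + 1) :=
    isRsopPart_finsetProd_pow_not_mem_pow hz S.attach (fun s => k s.1 (hSmem s.1 s.2)) (fun s => F.a s.1)
  rw [Finset.sum_attach S (fun i => F.a i)] at hMnot
  -- … and lies in `𝓜_y ≤ 𝓘_y ≤ 𝔪_yⁿ`: one factor per component, `1` for the components not through `y`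
  have key : ∀ i : Fin F.r, ∃ g : N.Y.presheaf.stalk y,
      g ∈ stalkIdeal ((vanishingIdeal (F.D i)) ^ F.a i) y ∧
        (∀ h : y ∈ (F.D i : Set N.Y), g = z (k i h) ^ F.a i) ∧ (y ∉ (F.D i : Set N.Y) → g = 1) := by
    intro i
    by_cases h : y ∈ (F.D i : Set N.Y)
    · refine ⟨z (k i h) ^ F.a i, ?_, fun _ => rfl, fun h' => absurd h h'⟩
      rw [stalkIdeal_pow, hk i h]
      exact Ideal.pow_mem_pow (Ideal.mem_span_singleton_self _) _
    · refine ⟨1, ?_, fun h' => absurd h' h, fun _ => rfl⟩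
      have htop : stalkIdeal (vanishingIdeal (F.D i)) y = ⊤ := by
        apply stalkIdeal_eq_top_of_not_mem_support
        rw [← SetLike.mem_coe, Scheme.IdealSheafData.coe_support_vanishingIdeal]
        exact h
      rw [stalkIdeal_pow, htop, Ideal.top_pow]
      exact Submodule.mem_top
  choose f hf hfz hf1 using key
  have hprod : ∏ i, f i ∈ stalkIdeal F.boundary y := by
    unfold boundary
    rw [stalkIdeal_finset_prod]
    exact Ideal.prod_mem_prod fun i _ => hf i
  have hfM : ∏ i, f i = ∏ s ∈ S.attach, z (k s.1 (hSmem s.1 s.2)) ^ F.a s.1 := by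
    rw [← Finset.prod_subset (Finset.subset_univ S) (fun i _ hi => hf1 i (hSnot i hi)), ← Finset.prod_attach S]
    exact Finset.prod_congr rfl fun s _ => hfz s.1 (hSmem s.1 s.2)
  rw [hfM] at hprod
  have hI : stalkIdeal N.I y ≤ maximalIdeal _ ^ n := (le_idealOrder_iff _ _ _).1 hy
  rw [hF, stalkIdeal_add] at hI
  exact hMnot (Ideal.pow_le_pow_right (by omega) (le_trans le_sup_right hI hprod))

/-- **THE LABEL RULE** (g33 window (1)(a), kernel, scheme level): on an s.n.c. frame in the ideal shape (`1 ≤ n`),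
`Supp(𝓘, n) = H ∩ {y | Σ_{Dᵢ ∋ y} aᵢ ≥ n}` — stated with a witnessing finite set of components through `y`. [new] [folklore] -/
theorem labelRule {n : ℕ} (hn : 1 ≤ n) {F : NCFrame N} (hS : F.IsSNC) (hF : F.IdealShape n) (y : N.Y) :
    (n : ℕ∞) ≤ idealOrder N.I y ↔
      y ∈ (F.H : Set N.Y) ∧ ∃ S : Finset (Fin F.r), (∀ i ∈ S, y ∈ (F.D i : Set N.Y)) ∧ n ≤ ∑ i ∈ S, F.a i :=
  ⟨fun hy => ⟨(top_subset_of_idealShape hn hF hy).1, labels_ge_of_le_idealOrder hS hF hy⟩,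
    fun ⟨hH, _, hS', hle⟩ => le_idealOrder_of_labels hF hH hS' hle⟩

end NCFrame

/-- the ideal-shape letter needs only the frame and the shape: `F.IsSNC → F.IdealShape n → 1 ≤ n → IsNCStage n N`.
[new] [folklore] -/
theorem isNCStage_of_idealShape {n : ℕ} (hn : 1 ≤ n) {N : Stage} {F : NCFrame N} (hS : F.IsSNC) (hF : F.IdealShape n) :
    IsNCStage n N :=
  ⟨F, hS, hF, NCFrame.suppLE_of_idealShape hn hF⟩

/-- **reading for data**: the support of an `n`-datum (`1 ≤ n`) whose stage carries an ideal-shape frame lies in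
`H ∩ ⋃_{aᵢ ≠ 0} Dᵢ` (`MarkedIdeal.support` = the top locus of the marking). [new] [folklore] -/
theorem support_subset_of_idealShape {n : ℕ} (hn : 1 ≤ n) {Y : Scheme.{0}} {M : MarkedIdeal Y} (hM : IsDatum n M)
    {F : NCFrame ⟨Y, M.ideal⟩} (hF : F.IdealShape n) :
    M.support ⊆ (F.H : Set Y) ∩ ⋃ i ∈ {i | F.a i ≠ 0}, (F.D i : Set Y) := by
  intro y hy
  have hy' : (n : ℕ∞) ≤ idealOrder M.ideal y := by
    have := hy
    simp only [MarkedIdeal.support, Set.mem_setOf_eq, hM.1] at this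
    exact this
  obtain ⟨hH, i, hi, hD⟩ := NCFrame.top_subset_of_idealShape (N := ⟨Y, M.ideal⟩) hn hF hy'
  exact ⟨hH, Set.mem_biUnion (show i ∈ {i | F.a i ≠ 0} from hi) hD⟩

/-- **reading for data, lower half**: for an `n`-datum whose stage carries an ideal-shape frame, a point of `H` on boundary
components of total label `≥ n` lies in the support of the marking. [new] [folklore] -/
theorem mem_support_of_labels {n : ℕ} {Y : Scheme.{0}} {M : MarkedIdeal Y} (hM : IsDatum n M) {F : NCFrame ⟨Y, M.ideal⟩}
    (hF : F.IdealShape n) {y : Y} (hyH : y ∈ (F.H : Set Y)) {S : Finset (Fin F.r)}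
    (hS : ∀ i ∈ S, y ∈ (F.D i : Set Y)) (hn : n ≤ ∑ i ∈ S, F.a i) : y ∈ M.support := by
  simp only [MarkedIdeal.support, Set.mem_setOf_eq, hM.1]
  exact NCFrame.le_idealOrder_of_labels (N := ⟨Y, M.ideal⟩) hF hyH hS hn

end NCSupport

end Summit.ResolutionOfSingularities.ResolutionOfSingularities.Theorems.DeltaCutClasses
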